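import Literature.NumberTheory.LFunctions.GallagherFejerKernel
import Literature.NumberTheory.Sieve.MontgomeryVaughan1975MajorArcs
import HarnessLib

/-!
# Gallagher's short-window mean-value lemma (general real frequencies), PROVED

Topic `Literature/NumberTheory/LFunctions`.  Everything in this file is PROVED (no named facts); it DISCHARGES the
tree's named fact `Literature.NumberTheory.Sieve.MontgomeryVaughan1975.lemma42_gallagher` (Montgomery–Vaughan 1975,
Lemma 4.2 = Gallagher 1970, Lemma 1, integer frequencies) with the absolute constant `π²`.

For a finite generalized trigonometric polynomial `S(t) = ∑_{i ∈ s} c_i e(ν_i t)` (`e(x) = exp(2πix)`, arbitrary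
real frequencies `ν_i`, complex coefficients `c_i`) and any `T, δ > 0` with `δ T ≤ 1/2`:

  `∫_{-T}^{T} |S(t)|² dt ≤ (π² / (4 δ²)) · ∑_{i,j} Re(c_i c̄_j) (δ − |ν_i − ν_j|)₊`   (`integral_normSq_trigPoly_le_windowForm`)
  `                  = (π² / (4 δ²)) · ∫_ℝ |∑_{i : x < ν_i ≤ x + δ} c_i|² dx`     (`integral_normSq_trigPoly_le`).

PROOF (the classical one, with Fourier inversion in place of Plancherel; toolkit in `GallagherFejerKernel.lean`):
`1_{[−T,T]} ≤ (π²/4δ²) K_δ` (Jordan), so `∫_{-T}^{T}|S|² ≤ (π²/4δ²) ∫ K_δ |S|²`; expanding `|S|²` and using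
`∫ K_δ(t) e(tu) dt = Δ_δ(u)` gives the WINDOW FORM `∑ c_i c̄_j Δ_δ(ν_i − ν_j)` (`integral_fejerK_mul_normSq`), and the
window form is the `x`-integral of the squared window sums because the windows of `ν_i` and `ν_j` overlap in
length `(δ − |ν_i − ν_j|)₊` (`windowForm_eq_integral`).  The integer-frequency corollary takes `δ = 1/(2ϰ)`,
`T = ϰ`; the closed window `[x, x + δ]` of the named fact and the half-open one differ only for `x ∈ {1,…,N}`
(measure zero).  The multiplicative (`n^{-it}`) form used for Dirichlet polynomials is the instance
`ν_n = −log n/(2π)`, `δ = 1/(2πT)` (filed separately).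

## References
* [Gallagher1970] P. X. Gallagher, *A large sieve density estimate near σ = 1*, Invent. Math. 11 (1970), Lemma 1.
* [Montgomery1971] H. L. Montgomery, *Topics in multiplicative number theory*, LNM 227 (1971), Lemma 1.9.
* [MontgomeryVaughanActa1975] H. L. Montgomery, R. C. Vaughan, *The exceptional set in Goldbach's problem*,
  Acta Arith. 27 (1975), Lemma 4.2.
-/

noncomputable section

open Real MeasureTheory Complex Finset Set
open scoped FourierTransform ComplexConjugate

namespace Literature.NumberTheory.LFunctions

namespace Gallagher

/-! ### Generalized trigonometric polynomials and the window form -/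

section Main

variable {ι : Type*}

/-- `S(t) = ∑_{i ∈ s} c_i e(ν_i t)`, `e(x) = exp(2πix)`. [cite: Gallagher1970, Lemma 1 (proof step)] -/
def trigPoly (s : Finset ι) (c : ι → ℂ) (ν : ι → ℝ) (t : ℝ) : ℂ :=
  ∑ i ∈ s, c i * cexp (↑(2 * π * ν i * t) * I)

/-- The WINDOW FORM `∑_{i,j} Re(c_i c̄_j) (δ − |ν_i − ν_j|)₊`. [cite: Gallagher1970, Lemma 1 (proof step)] -/
def windowForm (s : Finset ι) (c : ι → ℂ) (ν : ι → ℝ) (δ : ℝ) : ℝ :=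
  ∑ i ∈ s, ∑ j ∈ s, (c i * conj (c j)).re * tri δ (ν i - ν j)

/-- `S(t)` is continuous in `t`. [cite: Gallagher1970, Lemma 1 (proof step)] -/
theorem continuous_trigPoly (s : Finset ι) (c : ι → ℂ) (ν : ι → ℝ) : Continuous (trigPoly s c ν) := by
  unfold trigPoly
  refine continuous_finsetSum _ fun i _ => continuous_const.mul (Continuous.cexp ?_)
  exact (continuous_ofReal.comp (continuous_const.mul continuous_id)).mul continuous_const

/-- `|S(t)| ≤ ∑ |c_i|`. [cite: Gallagher1970, Lemma 1 (proof step)] -/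
theorem norm_trigPoly_le (s : Finset ι) (c : ι → ℂ) (ν : ι → ℝ) (t : ℝ) :
    ‖trigPoly s c ν t‖ ≤ ∑ i ∈ s, ‖c i‖ := by
  unfold trigPoly
  refine (norm_sum_le _ _).trans (le_of_eq (Finset.sum_congr rfl fun i _ => ?_))
  rw [norm_mul, Complex.norm_exp_ofReal_mul_I, mul_one]

/-- `|S(t)|²` as a double sum of exponentials. [cite: Gallagher1970, Lemma 1 (proof step)] -/
theorem normSq_trigPoly (s : Finset ι) (c : ι → ℂ) (ν : ι → ℝ) (t : ℝ) :
    ((‖trigPoly s c ν t‖ ^ 2 : ℝ) : ℂ) =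
      ∑ i ∈ s, ∑ j ∈ s, c i * conj (c j) * cexp (↑(2 * π * t * (ν i - ν j)) * I) := by
  have h : ((‖trigPoly s c ν t‖ ^ 2 : ℝ) : ℂ) = trigPoly s c ν t * conj (trigPoly s c ν t) := by
    rw [Complex.mul_conj']; push_cast; ring
  rw [h]
  unfold trigPoly
  rw [map_sum, Finset.sum_mul_sum]
  refine Finset.sum_congr rfl fun i _ => Finset.sum_congr rfl fun j _ => ?_
  rw [map_mul, ← Complex.exp_conj, map_mul, Complex.conj_ofReal, Complex.conj_I]
  rw [mul_mul_mul_comm, ← Complex.exp_add]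
  congr 1
  push_cast
  ring

/-- `K_δ` is continuous (real part of the continuous `𝓕 Δ_δ`). [cite: Gallagher1970, Lemma 1 (proof step)] -/
theorem continuous_fejerK {δ : ℝ} (hδ : 0 < δ) : Continuous (fejerK δ) := by
  have h := Complex.continuous_re.comp (continuous_fourier_triC hδ)
  convert h using 1
  funext t
  simp [fourier_triC hδ]

/-- `K_δ` is integrable as a complex-valued function. [cite: Gallagher1970, Lemma 1 (proof step)] -/
theorem integrable_fejerKC {δ : ℝ} (hδ : 0 < δ) : Integrable (fun t => (fejerK δ t : ℂ)) :=
  (integrable_fourier_triC hδ).congr (Filter.Eventually.of_forall fun t => fourier_triC hδ t)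

/-- `K_δ` is integrable. [cite: Gallagher1970, Lemma 1 (proof step)] -/
theorem integrable_fejerK {δ : ℝ} (hδ : 0 < δ) : Integrable (fejerK δ) := by
  have := (integrable_fejerKC hδ).re
  simpa using this

/-- `K_δ |S|²` is integrable (`|S|² ≤ (∑|c_i|)²`). [cite: Gallagher1970, Lemma 1 (proof step)] -/
theorem integrable_fejerK_mul_normSq {δ : ℝ} (hδ : 0 < δ) (s : Finset ι) (c : ι → ℂ) (ν : ι → ℝ) :
    Integrable (fun t => fejerK δ t * ‖trigPoly s c ν t‖ ^ 2) := by
  refine (integrable_fejerK hδ).mul_bdd (c := (∑ i ∈ s, ‖c i‖) ^ 2)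
    (((continuous_trigPoly s c ν).norm.pow 2).aestronglyMeasurable)
    (Filter.Eventually.of_forall fun t => ?_)
  rw [Real.norm_eq_abs, abs_of_nonneg (sq_nonneg _)]
  exact pow_le_pow_left₀ (norm_nonneg _) (norm_trigPoly_le s c ν t) 2

/-- **The key identity** `∫ K_δ(t) |S(t)|² dt = ∑_{i,j} Re(c_i c̄_j) Δ_δ(ν_i − ν_j)`. [cite: Gallagher1970, Lemma 1 (proof step)] -/
theorem integral_fejerK_mul_normSq {δ : ℝ} (hδ : 0 < δ) (s : Finset ι) (c : ι → ℂ) (ν : ι → ℝ) :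
    ∫ t, fejerK δ t * ‖trigPoly s c ν t‖ ^ 2 = windowForm s c ν δ := by
  have hterm : ∀ i ∈ s, ∀ j ∈ s, Integrable (fun t : ℝ =>
      c i * conj (c j) * ((fejerK δ t : ℂ) * cexp (↑(2 * π * t * (ν i - ν j)) * I))) := by
    intro i _ j _
    refine Integrable.const_mul ?_ _
    refine (integrable_fejerKC hδ).mul_bdd (c := 1) ?_ (Filter.Eventually.of_forall fun t => ?_)
    · exact (Continuous.cexp ((continuous_ofReal.comp (by continuity)).mul continuous_const)).aestronglyMeasurable
    · rw [Complex.norm_exp_ofReal_mul_I]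
  have hC : ((∫ t, fejerK δ t * ‖trigPoly s c ν t‖ ^ 2 : ℝ) : ℂ) =
      ∑ i ∈ s, ∑ j ∈ s, c i * conj (c j) * (tri δ (ν i - ν j) : ℂ) := by
    have hcast : (∫ t, ((fejerK δ t * ‖trigPoly s c ν t‖ ^ 2 : ℝ) : ℂ)) =
        ((∫ t, fejerK δ t * ‖trigPoly s c ν t‖ ^ 2 : ℝ) : ℂ) := integral_ofReal
    rw [← hcast]
    have hint : ∀ t : ℝ, ((fejerK δ t * ‖trigPoly s c ν t‖ ^ 2 : ℝ) : ℂ)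
        = ∑ i ∈ s, ∑ j ∈ s, c i * conj (c j) * ((fejerK δ t : ℂ) * cexp (↑(2 * π * t * (ν i - ν j)) * I)) := by
      intro t
      rw [Complex.ofReal_mul, normSq_trigPoly, Finset.mul_sum]
      refine Finset.sum_congr rfl fun i _ => ?_
      rw [Finset.mul_sum]
      refine Finset.sum_congr rfl fun j _ => by ring
    simp_rw [hint]
    rw [integral_finsetSum _ fun i hi => integrable_finsetSum _ fun j hj => hterm i hi j hj]
    refine Finset.sum_congr rfl fun i hi => ?_
    rw [integral_finsetSum _ fun j hj => hterm i hi j hj]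
    refine Finset.sum_congr rfl fun j _ => ?_
    rw [integral_const_mul, integral_fejerK_mul_cexp hδ]
  apply_fun Complex.re at hC
  rw [Complex.ofReal_re] at hC
  rw [hC, windowForm, Complex.re_sum]
  refine Finset.sum_congr rfl fun i _ => ?_
  rw [Complex.re_sum]
  refine Finset.sum_congr rfl fun j _ => ?_
  simp [Complex.mul_re]

/-- **Gallagher's lemma (window-form version).**  For `T, δ > 0` with `δT ≤ 1/2`:
`∫_{-T}^{T} |∑ c_i e(ν_i t)|² dt ≤ (π²/(4δ²)) ∑_{i,j} Re(c_i c̄_j)(δ − |ν_i − ν_j|)₊`.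
[cite: Gallagher1970, Lemma 1 — derivation] -/
theorem integral_normSq_trigPoly_le_windowForm (s : Finset ι) (c : ι → ℂ) (ν : ι → ℝ) {T δ : ℝ}
    (hT : 0 < T) (hδ : 0 < δ) (hδT : δ * T ≤ 1 / 2) :
    ∫ t in (-T)..T, ‖trigPoly s c ν t‖ ^ 2 ≤ π ^ 2 / (4 * δ ^ 2) * windowForm s c ν δ := by
  have hSc := continuous_trigPoly s c ν
  have hKc := continuous_fejerK hδ
  have hg := integrable_fejerK_mul_normSq hδ s c ν
  have h1 : ∫ t in (-T)..T, ‖trigPoly s c ν t‖ ^ 2 ≤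
      ∫ t in (-T)..T, π ^ 2 / (4 * δ ^ 2) * (fejerK δ t * ‖trigPoly s c ν t‖ ^ 2) := by
    refine intervalIntegral.integral_mono_on (by linarith) ((hSc.norm.pow 2).intervalIntegrable _ _)
      ((continuous_const.mul (hKc.mul (hSc.norm.pow 2))).intervalIntegrable _ _) fun t ht => ?_
    have habs : |t| ≤ T := abs_le.mpr ⟨by linarith [ht.1], ht.2⟩
    have hK := fejerK_ge hδ hδT habs
    have hone : 1 ≤ π ^ 2 / (4 * δ ^ 2) * fejerK δ t := by
      rw [div_mul_eq_mul_div, le_div_iff₀ (by positivity)]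
      rw [div_le_iff₀ (by positivity)] at hK
      linarith
    have h0 : 0 ≤ ‖trigPoly s c ν t‖ ^ 2 := sq_nonneg _
    nlinarith
  have h2 : ∫ t in (-T)..T, fejerK δ t * ‖trigPoly s c ν t‖ ^ 2 ≤
      ∫ t, fejerK δ t * ‖trigPoly s c ν t‖ ^ 2 := by
    rw [intervalIntegral.integral_of_le (by linarith)]
    exact setIntegral_le_integral hg
      (Filter.Eventually.of_forall fun t => mul_nonneg (fejerK_nonneg hδ t) (sq_nonneg _))
  rw [integral_fejerK_mul_normSq hδ] at h2
  calc ∫ t in (-T)..T, ‖trigPoly s c ν t‖ ^ 2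
      ≤ ∫ t in (-T)..T, π ^ 2 / (4 * δ ^ 2) * (fejerK δ t * ‖trigPoly s c ν t‖ ^ 2) := h1
    _ = π ^ 2 / (4 * δ ^ 2) * ∫ t in (-T)..T, fejerK δ t * ‖trigPoly s c ν t‖ ^ 2 :=
        intervalIntegral.integral_const_mul _ _
    _ ≤ π ^ 2 / (4 * δ ^ 2) * windowForm s c ν δ := mul_le_mul_of_nonneg_left h2 (by positivity)

end Main

/-! ### The window form is the `x`-integral of the squared window sums -/

section Window

variable {ι : Type*}

/-- The overlap set of the two windows `{x : x < ν_i ≤ x + δ}` and `{x : x < ν_j ≤ x + δ}`. [folklore] -/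
private def overlap (δ a b : ℝ) : Set ℝ := Ico (max a b - δ) (min a b)

/-- Membership in the overlap set = both window conditions. [folklore] -/
private theorem mem_overlap_iff {δ a b x : ℝ} :
    x ∈ overlap δ a b ↔ (x < a ∧ a ≤ x + δ) ∧ (x < b ∧ b ≤ x + δ) := by
  simp only [overlap, Set.mem_Ico, sub_le_iff_le_add, max_le_iff, lt_min_iff]
  tauto

/-- The overlap of the two windows has length `(δ − |a − b|)₊ = Δ_δ(a − b)`. [folklore] -/
private theorem volume_real_overlap {δ : ℝ} (a b : ℝ) :
    volume.real (overlap δ a b) = tri δ (a - b) := by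
  rw [overlap, Real.volume_real_Ico, tri]
  congr 1
  have := max_sub_min_eq_abs a b
  rw [abs_sub_comm] at this
  linarith

/-- Pointwise expansion of a squared FILTERED sum: `|∑_{i : P i} c_i|² = ∑_{i,j} Re(c_i c̄_j)·𝟙[P i ∧ P j]`.
[cite: Gallagher1970, Lemma 1 (proof step)] -/
theorem normSq_sum_filter (s : Finset ι) (c : ι → ℂ) (P : ι → Prop) [DecidablePred P] :
    ‖∑ i ∈ s with P i, c i‖ ^ 2 =
      ∑ i ∈ s, ∑ j ∈ s, (c i * conj (c j)).re * (if P i ∧ P j then (1:ℝ) else 0) := by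
  set w : ι → ℂ := fun i => if P i then c i else 0 with hw
  have hsum : ∑ i ∈ s with P i, c i = ∑ i ∈ s, w i := by
    rw [Finset.sum_filter]
  rw [hsum]
  have hsq : (‖∑ i ∈ s, w i‖ ^ 2 : ℝ) = ((∑ i ∈ s, w i) * conj (∑ i ∈ s, w i)).re := by
    rw [Complex.mul_conj']; norm_cast
  rw [hsq, map_sum, Finset.sum_mul_sum, Complex.re_sum]
  refine Finset.sum_congr rfl fun i _ => ?_
  rw [Complex.re_sum]
  refine Finset.sum_congr rfl fun j _ => ?_
  by_cases hi : P i
  · by_cases hj : P j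
    · simp [hw, hi, hj]
    · simp [hw, hj]
  · simp [hw, hi]

/-- Pointwise: `|∑_{x<ν_i≤x+δ} c_i|² = ∑_{i,j} Re(c_i c̄_j)·𝟙[x ∈ overlap_{ij}]`. [folklore] -/
private theorem normSq_windowSum (s : Finset ι) (c : ι → ℂ) (ν : ι → ℝ) (δ x : ℝ) :
    ‖∑ i ∈ s with (x < ν i ∧ ν i ≤ x + δ), c i‖ ^ 2 =
      ∑ i ∈ s, ∑ j ∈ s, (c i * conj (c j)).re * (overlap δ (ν i) (ν j)).indicator (fun _ => (1:ℝ)) x := by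
  rw [normSq_sum_filter]
  refine Finset.sum_congr rfl fun i _ => Finset.sum_congr rfl fun j _ => ?_
  congr 1
  by_cases hx : x ∈ overlap δ (ν i) (ν j)
  · rw [Set.indicator_of_mem hx, if_pos (mem_overlap_iff.mp hx)]
  · rw [Set.indicator_of_notMem hx, if_neg (fun h => hx (mem_overlap_iff.mpr h))]

/-- **The window form is the integral of the squared window sums**:
`∑_{i,j} Re(c_i c̄_j)(δ − |ν_i − ν_j|)₊ = ∫_ℝ |∑_{i : x < ν_i ≤ x + δ} c_i|² dx`. [cite: Gallagher1970, Lemma 1 (proof step)] -/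
theorem windowForm_eq_integral (s : Finset ι) (c : ι → ℂ) (ν : ι → ℝ) (δ : ℝ) :
    windowForm s c ν δ = ∫ x : ℝ, ‖∑ i ∈ s with (x < ν i ∧ ν i ≤ x + δ), c i‖ ^ 2 := by
  simp_rw [normSq_windowSum]
  have hterm : ∀ i ∈ s, ∀ j ∈ s, Integrable (fun x : ℝ =>
      (c i * conj (c j)).re * (overlap δ (ν i) (ν j)).indicator (fun _ => (1:ℝ)) x) := by
    intro i _ j _
    refine Integrable.const_mul ?_ _
    exact (integrableOn_const (by simp [overlap])).integrable_indicator measurableSet_Ico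
  rw [integral_finsetSum _ fun i hi => integrable_finsetSum _ fun j hj => hterm i hi j hj]
  refine Finset.sum_congr rfl fun i hi => ?_
  rw [integral_finsetSum _ fun j hj => hterm i hi j hj]
  refine Finset.sum_congr rfl fun j _ => ?_
  rw [integral_const_mul]
  congr 1
  rw [show overlap δ (ν i) (ν j) = Ico (max (ν i) (ν j) - δ) (min (ν i) (ν j)) from rfl,
    integral_indicator_const _ measurableSet_Ico, smul_eq_mul, mul_one]
  exact (volume_real_overlap (ν i) (ν j)).symm

/-- **Gallagher's lemma (integral version).**  For `T, δ > 0` with `δT ≤ 1/2`: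
`∫_{-T}^{T} |∑ c_i e(ν_i t)|² dt ≤ (π²/(4δ²)) ∫_ℝ |∑_{i : x < ν_i ≤ x + δ} c_i|² dx`.
[cite: Gallagher1970, Lemma 1 — derivation] -/
theorem integral_normSq_trigPoly_le (s : Finset ι) (c : ι → ℂ) (ν : ι → ℝ) {T δ : ℝ}
    (hT : 0 < T) (hδ : 0 < δ) (hδT : δ * T ≤ 1 / 2) :
    ∫ t in (-T)..T, ‖trigPoly s c ν t‖ ^ 2 ≤
      π ^ 2 / (4 * δ ^ 2) * ∫ x : ℝ, ‖∑ i ∈ s with (x < ν i ∧ ν i ≤ x + δ), c i‖ ^ 2 := by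
  rw [← windowForm_eq_integral s c ν δ]
  exact integral_normSq_trigPoly_le_windowForm s c ν hT hδ hδT

end Window

/-! ### Discharge of the tree's NAMED FACT `MontgomeryVaughan1975.lemma42_gallagher` (integer frequencies) -/

section IntegerFrequencies

/-- For `x` off the (finite) set of integer points `{1,…,N}`, the closed and the half-open windows agree. [folklore] -/
private theorem filter_window_eq {N : ℕ} {x δ : ℝ}
    (hx : x ∉ (fun n : ℕ => (n : ℝ)) '' ((Finset.Icc 1 N : Finset ℕ) : Set ℕ)) :
    (Finset.Icc 1 N).filter (fun n : ℕ => x < (n : ℝ) ∧ (n : ℝ) ≤ x + δ) =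
      (Finset.Icc 1 N).filter (fun n : ℕ => x ≤ (n : ℝ) ∧ (n : ℝ) ≤ x + δ) := by
  refine Finset.filter_congr fun n hn => ?_
  have hne : (n : ℝ) ≠ x := fun h => hx ⟨n, by exact_mod_cast hn, h⟩
  constructor
  · rintro ⟨h1, h2⟩; exact ⟨h1.le, h2⟩
  · rintro ⟨h1, h2⟩; exact ⟨lt_of_le_of_ne h1 hne.symm, h2⟩

/-- **DISCHARGE**: Gallagher's Lemma 1 in the integer-frequency form recorded as the named fact
`Literature.NumberTheory.Sieve.MontgomeryVaughan1975.lemma42_gallagher` (Montgomery–Vaughan 1975, Lemma 4.2)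
holds, with the absolute constant `C = π²`. [cite: Gallagher1970, Lemma 1 — derivation] -/
theorem lemma42_gallagher_holds : Literature.NumberTheory.Sieve.MontgomeryVaughan1975.lemma42_gallagher := by
  refine ⟨π ^ 2, fun N u ϰ hϰ => ?_⟩
  set δ : ℝ := (2 * ϰ)⁻¹ with hδdef
  have hδ : 0 < δ := by positivity
  have hδT : δ * ϰ ≤ 1 / 2 := by
    rw [hδdef]; apply le_of_eq; field_simp
  set s : Finset ℕ := Finset.Icc 1 N with hsdef
  have hmain := integral_normSq_trigPoly_le s (fun n => (u n : ℂ)) (fun n => (n : ℝ)) hϰ hδ hδT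
  have hL : ∫ η in (-ϰ)..ϰ, ‖∑ n ∈ s, (u n : ℂ) * (𝐞 (n * η) : ℂ)‖ ^ 2 =
      ∫ η in (-ϰ)..ϰ, ‖trigPoly s (fun n => (u n : ℂ)) (fun n => (n : ℝ)) η‖ ^ 2 := by
    refine intervalIntegral.integral_congr fun η _ => ?_
    simp only [trigPoly, Real.fourierChar_apply]
    congr 2
    refine Finset.sum_congr rfl fun n _ => ?_
    congr 2
    push_cast
    ring
  set B : Set ℝ := (fun n : ℕ => (n : ℝ)) '' (s : Set ℕ) with hBdef
  have hB : volume B = 0 := Set.Finite.measure_zero ((Finset.finite_toSet _).image _) _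
  have hae : ∀ᵐ x : ℝ, x ∉ B := by
    rw [ae_iff]
    have : {a : ℝ | ¬ a ∉ B} = B := by ext; simp
    rw [this]; exact hB
  have hR : ∫ x : ℝ, ‖∑ n ∈ s.filter (fun n : ℕ => x < (n : ℝ) ∧ (n : ℝ) ≤ x + δ), (u n : ℂ)‖ ^ 2 =
      ∫ x : ℝ, (∑ n ∈ s.filter (fun n : ℕ => x ≤ (n : ℝ) ∧ (n : ℝ) ≤ x + (2 * ϰ)⁻¹), u n) ^ 2 := by
    apply integral_congr_ae
    filter_upwards [hae] with x hx
    rw [filter_window_eq hx, ← hδdef]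
    rw [← Complex.ofReal_sum, Complex.norm_real, Real.norm_eq_abs, sq_abs]
  have hconst : π ^ 2 / (4 * δ ^ 2) = π ^ 2 * ϰ ^ 2 := by
    rw [hδdef]; field_simp; ring
  rw [hL]
  calc ∫ η in (-ϰ)..ϰ, ‖trigPoly s (fun n => (u n : ℂ)) (fun n => (n : ℝ)) η‖ ^ 2
      ≤ π ^ 2 / (4 * δ ^ 2) *
          ∫ x : ℝ, ‖∑ n ∈ s.filter (fun n : ℕ => x < (n : ℝ) ∧ (n : ℝ) ≤ x + δ), (u n : ℂ)‖ ^ 2 := hmain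
    _ = π ^ 2 * ∫ x : ℝ, (ϰ * ∑ n ∈ s.filter
          (fun n : ℕ => x ≤ (n : ℝ) ∧ (n : ℝ) ≤ x + (2 * ϰ)⁻¹), u n) ^ 2 := by
        rw [hconst, hR]
        simp_rw [mul_pow]
        rw [integral_const_mul]
        ring

end IntegerFrequencies

end Gallagher

end Literature.NumberTheory.LFunctions
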